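import Literature.Topology.FourManifolds.FibrewiseMorseLocalFrame
import Mathlib.Analysis.SpecialFunctions.SmoothTransition
import HarnessLib

/-!
# Patching adapted frames along an interval

Topic `Literature/Topology/FourManifolds`, third file of the frame cluster
(`FibrewiseMorseFrame.lean`: the global fibrewise Morse lemma GIVEN a global adapted frame;
`FibrewiseMorseLocalFrame.lean`: LOCAL adapted frames from Hirsch's lemma).  Here the local frames
are patched along a compact parameter interval: for a `C^∞` family `g : ℝ × V → ℝ` whose fibre
Hessians `H(t) = ∂ᵤ∂ᵤ g (t, 0)` are all nondegenerate, **every compact interval `[a, b]` has an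
open neighbourhood carrying a `C^∞` adapted frame** `Fr t` (`H(t) (x, y) = H(a) (Fr t x, Fr t y)`,
`Fr a = 1`, with `C^∞` inverse), `Splitting.exists_adaptedFrame_Icc`.  With
`Splitting.exists_fibrewiseMorseCoords_of_frame` this is the parametric Morse lemma over a
compact interval (Hirsch, *Differential Topology*, Ch. 6 §1, Thm. 1.1 with a parameter; the
interval case of the Morse–Bott lemma, Banyaga–Hurtubise 2004, Thm. 2).

The patching is elementary because frames are matrices: two frames adapted to the same
reference form differ by `C(t) = Fr t ∘ (Fr₁ t)⁻¹`, which preserves the reference form for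
every `t`; so `C(τ t) ∘ Fr₁ t` is again adapted for ANY function `τ`, and choosing a smooth
plateau `τ` (`τ t = t` to the left, `τ` frozen inside the overlap to the right) glues `Fr`
(left) to `C(τ ·) ∘ Fr₁` (right) smoothly — no path in the orthogonal group is needed.

* `Splitting.exists_plateau_const`, `Splitting.exists_plateau` — a `C^∞` `τ : ℝ → ℝ` with
  `τ t = t` for `t ≤ β₁`, `τ t ∈ [β₁, β₂]` for `t ≥ β₁` (and `τ t = β₂` for `t ≥ β₂`), from
  `Real.smoothTransition`.
* `Splitting.adaptedFrame_rebase` — a frame adapted to `H(m)` becomes a frame adapted to `H(a)`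
  after composing with the constant map `Fr s ∘ (Fr₁ s)⁻¹` read off at one common point `s`.
* `Splitting.exists_adaptedFrame_extend_const`, `Splitting.exists_adaptedFrame_extend` — **the
  gluing step**: frames on `U` and `U₁` adapted to the same reference form, with
  `[β₀, β₂] ⊆ U ∩ U₁`, glue to a frame on `(U ∩ (-∞, β₁)) ∪ (U₁ ∩ (β₀, ∞))` equal to the first
  one on `(-∞, β₁]` and to `C⋆ ∘ (second one)` on `[β₂, ∞)` for a fixed `H₀`-orthogonal `C⋆`.
* `Splitting.exists_adaptedFrame_Icc` — **frames along a compact interval**, by real induction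
  on `sup {s | [a, s] has a framed neighbourhood}` with the local frames of
  `Splitting.exists_local_adaptedFrame`.

Everything here is **proved**; no definition, no named fact.

## References

* M. W. Hirsch, *Differential Topology*, GTM 33 (1976), Ch. 6 §1, Thm. 1.1. [HirschDT1976]
* A. Banyaga, D. E. Hurtubise, *A proof of the Morse–Bott Lemma*, Expo. Math. 22 (2004),
  365–373, Thm. 2, §3. [BanyagaHurtubise2004]
-/

noncomputable section

set_option maxSynthPendingDepth 2

open Set Function Filter Module Metric
open scoped Topology ContDiff

namespace Literature.Topology.FourManifolds

namespace Splitting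

variable {V : Type*} [NormedAddCommGroup V] [NormedSpace ℝ V]

/-! ### A smooth plateau function -/

/-- **A smooth plateau, with its constant end.**  For `β₁ < β₂` there is a `C^∞` function
`τ : ℝ → ℝ` with `τ t = t` for `t ≤ β₁`, `β₁ ≤ τ t ≤ β₂` for `t ≥ β₁`, and `τ t = β₂` for
`t ≥ β₂`: `τ t = β₁ + (β₂ - β₁) ψ ((t - β₁)/(β₂ - β₁))` with `ψ x = x + S(x) (1 - x)`, `S`
Mathlib's `Real.smoothTransition`. [folklore] -/
theorem exists_plateau_const {β₁ β₂ : ℝ} (h : β₁ < β₂) :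
    ∃ τ : ℝ → ℝ, ContDiff ℝ ∞ τ ∧ (∀ t ≤ β₁, τ t = t) ∧ (∀ t, β₁ ≤ t → τ t ∈ Icc β₁ β₂) ∧
      ∀ t, β₂ ≤ t → τ t = β₂ := by
  have hd : 0 < β₂ - β₁ := sub_pos.2 h
  set ψ : ℝ → ℝ := fun x => x + Real.smoothTransition x * (1 - x) with hψ
  have hψs : ContDiff ℝ ∞ ψ :=
    contDiff_id.add (Real.smoothTransition.contDiff.mul (contDiff_const.sub contDiff_id))
  have hψ0 : ∀ x ≤ 0, ψ x = x := fun x hx => by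
    simp [hψ, Real.smoothTransition.zero_of_nonpos hx]
  have hψ1 : ∀ x, 1 ≤ x → ψ x = 1 := fun x hx => by
    simp only [hψ, Real.smoothTransition.one_of_one_le hx]
    ring
  have hψI : ∀ x, 0 ≤ x → 0 ≤ ψ x ∧ ψ x ≤ 1 := fun x hx => by
    have h0 : 0 ≤ Real.smoothTransition x := Real.smoothTransition.nonneg x
    have h1 : Real.smoothTransition x ≤ 1 := Real.smoothTransition.le_one x
    by_cases hx1 : x ≤ 1
    · simp only [hψ]
      constructor <;> nlinarith
    · have h' : Real.smoothTransition x = 1 :=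
        Real.smoothTransition.one_of_one_le (by linarith)
      simp only [hψ, h']
      constructor <;> linarith
  have hd' : β₂ - β₁ ≠ 0 := hd.ne'
  refine ⟨fun t => β₁ + (β₂ - β₁) * ψ ((t - β₁) / (β₂ - β₁)), ?_, fun t ht => ?_,
    fun t ht => ?_, fun t ht => ?_⟩
  · exact contDiff_const.add (contDiff_const.mul (hψs.comp
      ((contDiff_id.sub contDiff_const).div_const _)))
  · have hx : (t - β₁) / (β₂ - β₁) ≤ 0 := div_nonpos_of_nonpos_of_nonneg (by linarith) hd.le
    simp only [hψ0 _ hx]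
    field_simp
    ring
  · have hx : 0 ≤ (t - β₁) / (β₂ - β₁) := div_nonneg (by linarith) hd.le
    obtain ⟨h0, h1⟩ := hψI _ hx
    simp only [mem_Icc]
    constructor <;> nlinarith
  · have hx : 1 ≤ (t - β₁) / (β₂ - β₁) := by
      rw [le_div_iff₀ hd]
      linarith
    simp only [hψ1 _ hx]
    ring

/-- **A smooth plateau.**  For `β₁ < β₂` there is a `C^∞` function `τ : ℝ → ℝ` with `τ t = t`
for `t ≤ β₁` and `β₁ ≤ τ t ≤ β₂` for `t ≥ β₁`: `τ t = β₁ + (β₂ - β₁) ψ ((t - β₁)/(β₂ - β₁))`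
with `ψ x = x + S(x) (1 - x)`, `S` Mathlib's `Real.smoothTransition`. [folklore] -/
theorem exists_plateau {β₁ β₂ : ℝ} (h : β₁ < β₂) :
    ∃ τ : ℝ → ℝ, ContDiff ℝ ∞ τ ∧ (∀ t ≤ β₁, τ t = t) ∧ ∀ t, β₁ ≤ t → τ t ∈ Icc β₁ β₂ := by
  obtain ⟨τ, h1, h2, h3, -⟩ := exists_plateau_const h
  exact ⟨τ, h1, h2, h3⟩

/-! ### Re-referencing a frame -/

/-- **Changing the reference form of a frame.**  If `Fr₁` is adapted to the reference form `H₁`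
on `U₁` (`H t (x, y) = H₁ (Fr₁ t x, Fr₁ t y)`, with inverse `Frinv₁`), `s ∈ U₁`, and at `s`
the form `H s` is also `H₀ (F x, F y)` for some linear `F`, then `(F ∘ Frinv₁ s) ∘ Fr₁ t` is
adapted to `H₀` on `U₁`. [folklore] -/
theorem adaptedFrame_rebase {H : ℝ → V →L[ℝ] V →L[ℝ] ℝ} {H₀ H₁ : V →L[ℝ] V →L[ℝ] ℝ}
    {U₁ : Set ℝ} {Fr₁ Frinv₁ : ℝ → (V →L[ℝ] V)}
    (hri₁ : ∀ t ∈ U₁, ∀ a : V, Fr₁ t (Frinv₁ t a) = a)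
    (had₁ : ∀ t ∈ U₁, ∀ a b : V, H t a b = H₁ (Fr₁ t a) (Fr₁ t b))
    {s : ℝ} (hs : s ∈ U₁) {F : V →L[ℝ] V} (hF : ∀ a b : V, H s a b = H₀ (F a) (F b))
    {t : ℝ} (ht : t ∈ U₁) (a b : V) :
    H t a b = H₀ (F (Frinv₁ s (Fr₁ t a))) (F (Frinv₁ s (Fr₁ t b))) := by
  have key : ∀ x y : V, H₁ x y = H₀ (F (Frinv₁ s x)) (F (Frinv₁ s y)) := fun x y => by
    have h := had₁ s hs (Frinv₁ s x) (Frinv₁ s y)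
    rw [hri₁ s hs, hri₁ s hs] at h
    rw [← h, hF]
  rw [had₁ t ht, key]

/-! ### The gluing step -/

/-- `ContDiffOn` on the union of two open sets. [folklore] -/
theorem contDiffOn_union_of_isOpen {F : Type*} [NormedAddCommGroup F] [NormedSpace ℝ F]
    {f : ℝ → F} {A B : Set ℝ} (hA : IsOpen A) (hB : IsOpen B) (hfA : ContDiffOn ℝ ∞ f A)
    (hfB : ContDiffOn ℝ ∞ f B) : ContDiffOn ℝ ∞ f (A ∪ B) := by
  rintro t (ht | ht)
  · exact ((hfA t ht).contDiffAt (hA.mem_nhds ht)).contDiffWithinAt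
  · exact ((hfB t ht).contDiffAt (hB.mem_nhds ht)).contDiffWithinAt

/-- **Gluing two adapted frames across an overlap, with the constant transition exported.**
Let `Fr` (on the open `U`) and `Fr₁` (on the open `U₁`) be `C^∞` frames with `C^∞` inverses, both adapted to the same reference form `H₀`
(`H t (a, b) = H₀ (Fr t a, Fr t b)`, resp. with `Fr₁`), and let `β₀ < β₁ < β₂` with
`[β₀, β₂] ⊆ U ∩ U₁`.  Then there is a `C^∞` frame on `U' = (U ∩ (-∞, β₁)) ∪ (U₁ ∩ (β₀, ∞))`,
adapted to `H₀`, with `C^∞` inverse, equal to `Fr` on `(-∞, β₁]`.  Construction: with the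
transition `C t = Fr t ∘ Frinv₁ t` (which preserves `H₀` for `t ∈ U ∩ U₁`) and a plateau `τ`
(`exists_plateau`), the new frame is `Fr t` for `t ≤ β₁` and `C (τ t) ∘ Fr₁ t` for `t > β₁`; the
two formulas agree on `(β₀, β₁]`, where `τ t = t`; for `t ≥ β₂` the plateau is constant, so
there the new frame is `C⋆ ∘ Fr₁ t` with the FIXED `H₀`-orthogonal map `C⋆ = C β₂` (this is
what makes frames with prescribed behaviour at both ends of an interval). [folklore] -/
theorem exists_adaptedFrame_extend_const {H : ℝ → V →L[ℝ] V →L[ℝ] ℝ} {H₀ : V →L[ℝ] V →L[ℝ] ℝ}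
    {U : Set ℝ} (hU : IsOpen U) {Fr Frinv : ℝ → (V →L[ℝ] V)}
    (hFr : ContDiffOn ℝ ∞ Fr U) (hFrinv : ContDiffOn ℝ ∞ Frinv U)
    (hri : ∀ t ∈ U, ∀ a : V, Fr t (Frinv t a) = a) (hli : ∀ t ∈ U, ∀ a : V, Frinv t (Fr t a) = a)
    (had : ∀ t ∈ U, ∀ a b : V, H t a b = H₀ (Fr t a) (Fr t b))
    {U₁ : Set ℝ} (hU₁ : IsOpen U₁) {Fr₁ Frinv₁ : ℝ → (V →L[ℝ] V)}
    (hFr₁ : ContDiffOn ℝ ∞ Fr₁ U₁) (hFrinv₁ : ContDiffOn ℝ ∞ Frinv₁ U₁)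
    (hri₁ : ∀ t ∈ U₁, ∀ a : V, Fr₁ t (Frinv₁ t a) = a)
    (hli₁ : ∀ t ∈ U₁, ∀ a : V, Frinv₁ t (Fr₁ t a) = a)
    (had₁ : ∀ t ∈ U₁, ∀ a b : V, H t a b = H₀ (Fr₁ t a) (Fr₁ t b))
    {β₀ β₁ β₂ : ℝ} (h01 : β₀ < β₁) (h12 : β₁ < β₂) (hsub : Icc β₀ β₂ ⊆ U ∩ U₁) :
    ∃ (Fr' Frinv' : ℝ → (V →L[ℝ] V)) (Cst Cstinv : V →L[ℝ] V),
      ContDiffOn ℝ ∞ Fr' ((U ∩ Iio β₁) ∪ (U₁ ∩ Ioi β₀)) ∧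
      ContDiffOn ℝ ∞ Frinv' ((U ∩ Iio β₁) ∪ (U₁ ∩ Ioi β₀)) ∧
      (∀ t ∈ (U ∩ Iio β₁) ∪ (U₁ ∩ Ioi β₀), ∀ a : V, Fr' t (Frinv' t a) = a) ∧
      (∀ t ∈ (U ∩ Iio β₁) ∪ (U₁ ∩ Ioi β₀), ∀ a : V, Frinv' t (Fr' t a) = a) ∧
      (∀ t ∈ (U ∩ Iio β₁) ∪ (U₁ ∩ Ioi β₀), ∀ a b : V, H t a b = H₀ (Fr' t a) (Fr' t b)) ∧
      (∀ t ≤ β₁, Fr' t = Fr t) ∧ (∀ t ≤ β₁, Frinv' t = Frinv t) ∧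
      (∀ a b : V, H₀ (Cst a) (Cst b) = H₀ a b) ∧ (∀ a : V, Cst (Cstinv a) = a) ∧
      (∀ a : V, Cstinv (Cst a) = a) ∧ (∀ t, β₂ ≤ t → Fr' t = Cst.comp (Fr₁ t)) ∧
      ∀ t, β₂ ≤ t → Frinv' t = (Frinv₁ t).comp Cstinv := by
  obtain ⟨τ, hτs, hτle, hτI, hτc⟩ := exists_plateau_const h12
  -- `τ` maps `(β₀, ∞)` into `(β₀, β₂] ⊆ U ∩ U₁`
  have hτmem : ∀ t, β₀ < t → τ t ∈ U ∩ U₁ := fun t ht => by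
    by_cases htb : t ≤ β₁
    · rw [hτle t htb]
      exact hsub ⟨ht.le, by linarith⟩
    · obtain ⟨h1, h2⟩ := hτI t (by linarith)
      exact hsub ⟨by linarith, h2⟩
  -- the transition `C t = Fr t ∘ Frinv₁ t` and its inverse
  set C : ℝ → (V →L[ℝ] V) := fun t => (Fr t).comp (Frinv₁ t) with hC
  set Cinv : ℝ → (V →L[ℝ] V) := fun t => (Fr₁ t).comp (Frinv t) with hCinv
  have hCs : ContDiffOn ℝ ∞ C (U ∩ U₁) :=
    (hFr.mono inter_subset_left).clm_comp (hFrinv₁.mono inter_subset_right)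
  have hCinvs : ContDiffOn ℝ ∞ Cinv (U ∩ U₁) :=
    (hFr₁.mono inter_subset_right).clm_comp (hFrinv.mono inter_subset_left)
  have hCorth : ∀ u ∈ U ∩ U₁, ∀ x y : V, H₀ (C u x) (C u y) = H₀ x y := fun u hu x y => by
    simp only [hC, ContinuousLinearMap.comp_apply]
    rw [← had u hu.1, had₁ u hu.2, hri₁ u hu.2, hri₁ u hu.2]
  have hCC : ∀ u ∈ U ∩ U₁, ∀ x : V, C u (Cinv u x) = x := fun u hu x => by
    simp only [hC, hCinv, ContinuousLinearMap.comp_apply, hli₁ u hu.2, hri u hu.1]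
  have hCC' : ∀ u ∈ U ∩ U₁, ∀ x : V, Cinv u (C u x) = x := fun u hu x => by
    simp only [hC, hCinv, ContinuousLinearMap.comp_apply, hli u hu.1, hri₁ u hu.2]
  have hCFr₁ : ∀ u ∈ U₁, ∀ x : V, C u (Fr₁ u x) = Fr u x := fun u hu x => by
    simp only [hC, ContinuousLinearMap.comp_apply, hli₁ u hu]
  -- the glued frame
  set Fr' : ℝ → (V →L[ℝ] V) := fun t => if t ≤ β₁ then Fr t else (C (τ t)).comp (Fr₁ t)
    with hFr'
  set Frinv' : ℝ → (V →L[ℝ] V) :=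
    fun t => if t ≤ β₁ then Frinv t else (Frinv₁ t).comp (Cinv (τ t)) with hFrinv'
  -- on `(β₀, ∞) ∩ U₁` the glued frame is `C (τ t) ∘ Fr₁ t`, with inverse `Frinv₁ t ∘ Cinv (τ t)`
  have hform : ∀ t ∈ U₁ ∩ Ioi β₀, Fr' t = (C (τ t)).comp (Fr₁ t) := fun t ht => by
    by_cases htb : t ≤ β₁
    · simp only [hFr', if_pos htb]
      ext x
      rw [ContinuousLinearMap.comp_apply, hτle t htb, hCFr₁ t ht.1]
    · simp only [hFr', if_neg htb]
  have hform' : ∀ t ∈ U₁ ∩ Ioi β₀, Frinv' t = (Frinv₁ t).comp (Cinv (τ t)) := fun t ht => by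
    by_cases htb : t ≤ β₁
    · simp only [hFrinv', if_pos htb]
      have htU : t ∈ U ∩ U₁ := hsub ⟨le_of_lt ht.2, by linarith⟩
      ext x
      rw [ContinuousLinearMap.comp_apply, hτle t htb]
      -- `Frinv t x = Frinv₁ t (Cinv t x)` since `Fr t (Frinv₁ t (Cinv t x)) = C t (Cinv t x) = x`
      have h1 : Fr t (Frinv₁ t (Cinv t x)) = x := hCC t htU x
      have h2 : Fr t (Frinv t x) = x := hri t htU.1 x
      have hinj : Injective (Fr t) := fun p q hpq => by
        rw [← hli t htU.1 p, ← hli t htU.1 q, hpq]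
      exact hinj (by rw [h2, h1])
    · simp only [hFrinv', if_neg htb]
  have hleft : ∀ t ≤ β₁, Fr' t = Fr t := fun t ht => by simp only [hFr', if_pos ht]
  have hleft' : ∀ t ≤ β₁, Frinv' t = Frinv t := fun t ht => by simp only [hFrinv', if_pos ht]
  -- smoothness
  have hO₂ : IsOpen (U₁ ∩ Ioi β₀) := hU₁.inter isOpen_Ioi
  have hO₁ : IsOpen (U ∩ Iio β₁) := hU.inter isOpen_Iio
  have hmaps : MapsTo τ (U₁ ∩ Ioi β₀) (U ∩ U₁) := fun t ht => hτmem t ht.2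
  have hCτ : ContDiffOn ℝ ∞ (fun t => C (τ t)) (U₁ ∩ Ioi β₀) := hCs.comp hτs.contDiffOn hmaps
  have hCinvτ : ContDiffOn ℝ ∞ (fun t => Cinv (τ t)) (U₁ ∩ Ioi β₀) :=
    hCinvs.comp hτs.contDiffOn hmaps
  have hFr's : ContDiffOn ℝ ∞ Fr' ((U ∩ Iio β₁) ∪ (U₁ ∩ Ioi β₀)) := by
    refine contDiffOn_union_of_isOpen hO₁ hO₂ ?_ ?_
    · exact (hFr.mono inter_subset_left).congr fun t ht => hleft t (le_of_lt ht.2)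
    · exact (hCτ.clm_comp (hFr₁.mono inter_subset_left)).congr hform
  have hFrinv's : ContDiffOn ℝ ∞ Frinv' ((U ∩ Iio β₁) ∪ (U₁ ∩ Ioi β₀)) := by
    refine contDiffOn_union_of_isOpen hO₁ hO₂ ?_ ?_
    · exact (hFrinv.mono inter_subset_left).congr fun t ht => hleft' t (le_of_lt ht.2)
    · exact ((hFrinv₁.mono inter_subset_left).clm_comp hCinvτ).congr hform'
  have hβ₂ : β₂ ∈ U ∩ U₁ := hsub ⟨(h01.trans h12).le, le_rfl⟩
  refine ⟨Fr', Frinv', C β₂, Cinv β₂, hFr's, hFrinv's, ?_, ?_, ?_, hleft, hleft', hCorth β₂ hβ₂,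
    hCC β₂ hβ₂, hCC' β₂ hβ₂, fun t ht => ?_, fun t ht => ?_⟩
  · rintro t (ht | ht) a
    · rw [hleft t (le_of_lt ht.2), hleft' t (le_of_lt ht.2), hri t ht.1]
    · rw [hform t ht, hform' t ht]
      simp only [ContinuousLinearMap.comp_apply, hri₁ t ht.1, hCC (τ t) (hτmem t ht.2)]
  · rintro t (ht | ht) a
    · rw [hleft t (le_of_lt ht.2), hleft' t (le_of_lt ht.2), hli t ht.1]
    · rw [hform t ht, hform' t ht]
      simp only [ContinuousLinearMap.comp_apply, hCC' (τ t) (hτmem t ht.2), hli₁ t ht.1]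
  · rintro t (ht | ht) a b
    · rw [hleft t (le_of_lt ht.2), had t ht.1]
    · rw [hform t ht]
      simp only [ContinuousLinearMap.comp_apply, hCorth (τ t) (hτmem t ht.2)]
      exact had₁ t ht.1 a b
  · have htb : ¬ t ≤ β₁ := not_le.2 (h12.trans_le ht)
    simp only [hFr', if_neg htb, hτc t ht]
  · have htb : ¬ t ≤ β₁ := not_le.2 (h12.trans_le ht)
    simp only [hFrinv', if_neg htb, hτc t ht]

/-- **Gluing two adapted frames across an overlap.**  Let `Fr` (on the open `U`) and `Fr₁` (on the
open `U₁`) be `C^∞` frames with `C^∞` inverses, both adapted to the same reference form `H₀`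
(`H t (a, b) = H₀ (Fr t a, Fr t b)`, resp. with `Fr₁`), and let `β₀ < β₁ < β₂` with
`[β₀, β₂] ⊆ U ∩ U₁`.  Then there is a `C^∞` frame on `U' = (U ∩ (-∞, β₁)) ∪ (U₁ ∩ (β₀, ∞))`,
adapted to `H₀`, with `C^∞` inverse, equal to `Fr` on `(-∞, β₁]`.  Construction: with the
transition `C t = Fr t ∘ Frinv₁ t` (which preserves `H₀` for `t ∈ U ∩ U₁`) and a plateau `τ`
(`exists_plateau`), the new frame is `Fr t` for `t ≤ β₁` and `C (τ t) ∘ Fr₁ t` for `t > β₁`; the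
two formulas agree on `(β₀, β₁]`, where `τ t = t`. [folklore] -/
theorem exists_adaptedFrame_extend {H : ℝ → V →L[ℝ] V →L[ℝ] ℝ} {H₀ : V →L[ℝ] V →L[ℝ] ℝ}
    {U : Set ℝ} (hU : IsOpen U) {Fr Frinv : ℝ → (V →L[ℝ] V)}
    (hFr : ContDiffOn ℝ ∞ Fr U) (hFrinv : ContDiffOn ℝ ∞ Frinv U)
    (hri : ∀ t ∈ U, ∀ a : V, Fr t (Frinv t a) = a) (hli : ∀ t ∈ U, ∀ a : V, Frinv t (Fr t a) = a)
    (had : ∀ t ∈ U, ∀ a b : V, H t a b = H₀ (Fr t a) (Fr t b))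
    {U₁ : Set ℝ} (hU₁ : IsOpen U₁) {Fr₁ Frinv₁ : ℝ → (V →L[ℝ] V)}
    (hFr₁ : ContDiffOn ℝ ∞ Fr₁ U₁) (hFrinv₁ : ContDiffOn ℝ ∞ Frinv₁ U₁)
    (hri₁ : ∀ t ∈ U₁, ∀ a : V, Fr₁ t (Frinv₁ t a) = a)
    (hli₁ : ∀ t ∈ U₁, ∀ a : V, Frinv₁ t (Fr₁ t a) = a)
    (had₁ : ∀ t ∈ U₁, ∀ a b : V, H t a b = H₀ (Fr₁ t a) (Fr₁ t b))
    {β₀ β₁ β₂ : ℝ} (h01 : β₀ < β₁) (h12 : β₁ < β₂) (hsub : Icc β₀ β₂ ⊆ U ∩ U₁) :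
    ∃ Fr' Frinv' : ℝ → (V →L[ℝ] V),
      ContDiffOn ℝ ∞ Fr' ((U ∩ Iio β₁) ∪ (U₁ ∩ Ioi β₀)) ∧
      ContDiffOn ℝ ∞ Frinv' ((U ∩ Iio β₁) ∪ (U₁ ∩ Ioi β₀)) ∧
      (∀ t ∈ (U ∩ Iio β₁) ∪ (U₁ ∩ Ioi β₀), ∀ a : V, Fr' t (Frinv' t a) = a) ∧
      (∀ t ∈ (U ∩ Iio β₁) ∪ (U₁ ∩ Ioi β₀), ∀ a : V, Frinv' t (Fr' t a) = a) ∧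
      (∀ t ∈ (U ∩ Iio β₁) ∪ (U₁ ∩ Ioi β₀), ∀ a b : V, H t a b = H₀ (Fr' t a) (Fr' t b)) ∧
      ∀ t ≤ β₁, Fr' t = Fr t := by
  obtain ⟨Fr', Frinv', -, -, h1, h2, h3, h4, h5, h6, -⟩ :=
    exists_adaptedFrame_extend_const hU hFr hFrinv hri hli had hU₁ hFr₁ hFrinv₁ hri₁ hli₁ had₁ h01
      h12 hsub
  exact ⟨Fr', Frinv', h1, h2, h3, h4, h5, h6⟩

/-! ### Frames along a compact interval -/

/-- **Adapted frames along a compact interval.**  Let `g : ℝ × V → ℝ` be `C^∞` (`V`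
finite-dimensional) with nondegenerate fibre Hessians `H(t) = ∂ᵤ∂ᵤ g (t, 0)` for all `t`.  Then
for `a ≤ b` there are an open `U ⊇ [a, b]` and `C^∞` maps `Fr Frinv : ℝ → (V →L V)`, mutually
inverse on `U`, with `Fr a = 1` and `H(t) (x, y) = H(a) (Fr t x, Fr t y)` for `t ∈ U`.  Proof by
real induction: let `m` be the supremum of the `s ∈ [a, b]` such that `[a, s]` has a framed
open neighbourhood; a local frame at `m` (`exists_local_adaptedFrame`), re-referenced to `H(a)`
at a point `s` close to `m` with `[a, s]` framed (`adaptedFrame_rebase`) and glued to that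
frame (`exists_adaptedFrame_extend`), frames `[a, m + ε/2]`; hence `m = b` and `[a, b]` is framed.
[cite: HirschDT1976, Ch. 6 §1, Thm. 1.1] [cite: BanyagaHurtubise2004, Thm. 2] -/
theorem exists_adaptedFrame_Icc [FiniteDimensional ℝ V] {g : ℝ × V → ℝ} (hg : ContDiff ℝ ∞ g)
    (hH : ∀ (t : ℝ) (a : V),
      (∀ b, fderiv ℝ (fderiv ℝ g) (t, 0) ((0 : ℝ), a) ((0 : ℝ), b) = 0) → a = 0)
    {a₀ b₀ : ℝ} (hab : a₀ ≤ b₀) :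
    ∃ (U : Set ℝ) (Fr Frinv : ℝ → (V →L[ℝ] V)), IsOpen U ∧ Icc a₀ b₀ ⊆ U ∧
      ContDiffOn ℝ ∞ Fr U ∧ ContDiffOn ℝ ∞ Frinv U ∧ Fr a₀ = ContinuousLinearMap.id ℝ V ∧
      (∀ t ∈ U, ∀ a : V, Fr t (Frinv t a) = a) ∧ (∀ t ∈ U, ∀ a : V, Frinv t (Fr t a) = a) ∧
      ∀ t ∈ U, ∀ a b : V, fderiv ℝ (fderiv ℝ g) (t, 0) ((0 : ℝ), a) ((0 : ℝ), b) =
        fderiv ℝ (fderiv ℝ g) (a₀, 0) ((0 : ℝ), Fr t a) ((0 : ℝ), Fr t b) := by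
  -- the Hessian family as a family of bilinear maps
  obtain ⟨H, hHap⟩ : ∃ H : ℝ → V →L[ℝ] V →L[ℝ] ℝ, ∀ (t : ℝ) (a b : V),
      H t a b = fderiv ℝ (fderiv ℝ g) (t, 0) ((0 : ℝ), a) ((0 : ℝ), b) :=
    ⟨fun t => (fderiv ℝ (fderiv ℝ g) (t, 0)).bilinearComp (ContinuousLinearMap.inr ℝ ℝ V)
      (ContinuousLinearMap.inr ℝ ℝ V), fun t a b => by simp⟩
  -- local frames (Hirsch), in terms of `H`
  have hloc : ∀ m : ℝ, ∃ (U : Set ℝ) (Fr Frinv : ℝ → (V →L[ℝ] V)), IsOpen U ∧ m ∈ U ∧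
      ContDiffOn ℝ ∞ Fr U ∧ ContDiffOn ℝ ∞ Frinv U ∧ Fr m = ContinuousLinearMap.id ℝ V ∧
      (∀ t ∈ U, ∀ a : V, Fr t (Frinv t a) = a) ∧ (∀ t ∈ U, ∀ a : V, Frinv t (Fr t a) = a) ∧
      ∀ t ∈ U, ∀ a b : V, H t a b = H m (Fr t a) (Fr t b) := fun m => by
    obtain ⟨U, Fr, Frinv, hU, hm, hFr, hFrinv, h1, hri, hli, had⟩ :=
      exists_local_adaptedFrame (P := ℝ) hg hH m
    refine ⟨U, Fr, Frinv, hU, hm, hFr, hFrinv, h1, hri, hli, fun t ht a b => ?_⟩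
    rw [hHap, hHap]
    exact had t ht a b
  -- the property propagated by real induction: `[a₀, s]` has a framed open neighbourhood
  set Good : ℝ → Prop := fun s => ∃ (U : Set ℝ) (Fr Frinv : ℝ → (V →L[ℝ] V)), IsOpen U ∧
    Icc a₀ s ⊆ U ∧ ContDiffOn ℝ ∞ Fr U ∧ ContDiffOn ℝ ∞ Frinv U ∧
    Fr a₀ = ContinuousLinearMap.id ℝ V ∧
    (∀ t ∈ U, ∀ a : V, Fr t (Frinv t a) = a) ∧ (∀ t ∈ U, ∀ a : V, Frinv t (Fr t a) = a) ∧
    ∀ t ∈ U, ∀ a b : V, H t a b = H a₀ (Fr t a) (Fr t b) with hGood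
  suffices hgood : Good b₀ by
    obtain ⟨U, Fr, Frinv, hU, hsub, hFr, hFrinv, h1, hri, hli, had⟩ := hgood
    refine ⟨U, Fr, Frinv, hU, hsub, hFr, hFrinv, h1, hri, hli, fun t ht a b => ?_⟩
    rw [← hHap, ← hHap]
    exact had t ht a b
  have hmono : ∀ s s', s' ≤ s → Good s → Good s' := by
    rintro s s' hss ⟨U, Fr, Frinv, hU, hsub, rest⟩
    exact ⟨U, Fr, Frinv, hU, (Icc_subset_Icc_right hss).trans hsub, rest⟩
  have hgood₀ : Good a₀ := by
    obtain ⟨U, Fr, Frinv, hU, hm, rest⟩ := hloc a₀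
    refine ⟨U, Fr, Frinv, hU, fun t ht => ?_, rest⟩
    rw [Icc_self, mem_singleton_iff] at ht
    rwa [ht]
  -- the extension step: a framed `[a₀, s]` with `s` close to `m` yields a framed `[a₀, m + ε/2]`
  have hstep : ∀ m : ℝ, ∃ ε > 0, ∀ s, a₀ ≤ s → m - ε < s → s ≤ m → Good s →
      Good (m + ε / 2) := by
    intro m
    obtain ⟨U₁, Fr₁, Frinv₁, hU₁, hm, hFr₁, hFrinv₁, -, hri₁, hli₁, had₁⟩ := hloc m
    obtain ⟨ε, hε, hball⟩ := Metric.isOpen_iff.1 hU₁ m hm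
    rw [Real.ball_eq_Ioo] at hball
    refine ⟨ε, hε, fun s has hms hsm hgs => ?_⟩
    obtain ⟨U, Fr, Frinv, hU, hsub, hFr, hFrinv, h1, hri, hli, had⟩ := hgs
    have hsU : s ∈ U := hsub (right_mem_Icc.2 has)
    have hsU₁ : s ∈ U₁ := hball ⟨hms, by linarith⟩
    obtain ⟨δ, hδ, hballU⟩ := Metric.isOpen_iff.1 hU s hsU
    rw [Real.ball_eq_Ioo] at hballU
    -- re-reference the local frame at `m` to `H a₀`, through `Fr s`
    set Fr₂ : ℝ → (V →L[ℝ] V) := fun t => ((Fr s).comp (Frinv₁ s)).comp (Fr₁ t) with hFr₂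
    set Frinv₂ : ℝ → (V →L[ℝ] V) := fun t => (Frinv₁ t).comp ((Fr₁ s).comp (Frinv s))
      with hFrinv₂
    have hFr₂s : ContDiffOn ℝ ∞ Fr₂ U₁ := contDiffOn_const.clm_comp hFr₁
    have hFrinv₂s : ContDiffOn ℝ ∞ Frinv₂ U₁ := hFrinv₁.clm_comp contDiffOn_const
    have hri₂ : ∀ t ∈ U₁, ∀ a : V, Fr₂ t (Frinv₂ t a) = a := fun t ht a => by
      simp only [hFr₂, hFrinv₂, ContinuousLinearMap.comp_apply, hri₁ t ht, hli₁ s hsU₁,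
        hri s hsU]
    have hli₂ : ∀ t ∈ U₁, ∀ a : V, Frinv₂ t (Fr₂ t a) = a := fun t ht a => by
      simp only [hFr₂, hFrinv₂, ContinuousLinearMap.comp_apply, hli s hsU, hri₁ s hsU₁,
        hli₁ t ht]
    have had₂ : ∀ t ∈ U₁, ∀ a b : V, H t a b = H a₀ (Fr₂ t a) (Fr₂ t b) := fun t ht a b => by
      simp only [hFr₂, ContinuousLinearMap.comp_apply]
      exact adaptedFrame_rebase hri₁ had₁ hsU₁ (had s hsU) ht a b
    -- glue across `[s - ρ/2, s + ρ/2] ⊆ U ∩ U₁`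
    set ρ : ℝ := min δ (min (s - (m - ε)) (m + ε - s)) with hρ
    have hρpos : 0 < ρ := lt_min hδ (lt_min (by linarith) (by linarith))
    have hρδ : ρ ≤ δ := min_le_left _ _
    have hρ₁ : ρ ≤ s - (m - ε) := (min_le_right _ _).trans (min_le_left _ _)
    have hρ₂ : ρ ≤ m + ε - s := (min_le_right _ _).trans (min_le_right _ _)
    have hIcc : Icc (s - ρ / 2) (s + ρ / 2) ⊆ U ∩ U₁ := fun t ht => by
      obtain ⟨ht1, ht2⟩ := ht
      exact ⟨hballU ⟨by linarith, by linarith⟩, hball ⟨by linarith, by linarith⟩⟩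
    obtain ⟨Fr', Frinv', hFr's, hFrinv's, hri', hli', had', hleft⟩ :=
      exists_adaptedFrame_extend hU hFr hFrinv hri hli had hU₁ hFr₂s hFrinv₂s hri₂ hli₂ had₂
        (show s - ρ / 2 < s by linarith) (show s < s + ρ / 2 by linarith) hIcc
    refine ⟨(U ∩ Iio s) ∪ (U₁ ∩ Ioi (s - ρ / 2)), Fr', Frinv',
      (hU.inter isOpen_Iio).union (hU₁.inter isOpen_Ioi), fun t ht => ?_, hFr's, hFrinv's,
      by rw [hleft a₀ has, h1], hri', hli', had'⟩
    by_cases hts : t < s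
    · exact Or.inl ⟨hsub ⟨ht.1, hts.le⟩, hts⟩
    · rw [not_lt] at hts
      exact Or.inr ⟨hball ⟨by linarith, by linarith [ht.2]⟩, show s - ρ / 2 < t by linarith⟩
  -- real induction on `sSup S`, `S = {s ∈ [a₀, b₀] | Good s}`
  set S : Set ℝ := {s | a₀ ≤ s ∧ s ≤ b₀ ∧ Good s} with hS
  have ha₀S : a₀ ∈ S := ⟨le_rfl, hab, hgood₀⟩
  have hSbdd : BddAbove S := ⟨b₀, fun s hs => hs.2.1⟩
  have hSne : S.Nonempty := ⟨a₀, ha₀S⟩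
  obtain ⟨ε, hε, hε'⟩ := hstep (sSup S)
  obtain ⟨s, hsS, hms⟩ := exists_lt_of_lt_csSup hSne (show sSup S - ε < sSup S by linarith)
  have hsm : s ≤ sSup S := le_csSup hSbdd hsS
  have hgood' : Good (sSup S + ε / 2) := hε' s hsS.1 hms hsm hsS.2.2
  have ham : a₀ ≤ sSup S := le_csSup hSbdd ha₀S
  by_contra hnot
  have hle : sSup S + ε / 2 ≤ b₀ := by
    by_contra h
    rw [not_le] at h
    exact hnot (hmono _ _ h.le hgood')
  have hmem : sSup S + ε / 2 ∈ S := ⟨by linarith, hle, hgood'⟩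
  have := le_csSup hSbdd hmem
  linarith

end Splitting

end Literature.Topology.FourManifolds
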